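import Mathlib
import HarnessLib
import Literature.NumberTheory.LFunctions.ZetaScrew
import Literature.NumberTheory.LFunctions.ZetaScrewThm41Proofs
import Summits.RiemannHypothesis.RiemannHypothesis.Theorems.IntegerScrewHingeCarrier
import Summits.RiemannHypothesis.RiemannHypothesis.Theorems.IntegerScrewHingeCovariance
import Summits.RiemannHypothesis.RiemannHypothesis.Theorems.IntegerScrewFarBrackets

/-!
# Route `IntegerScrew` — FAR DECORRELATION at every NON-INTEGER ratio:
# `M·Cov(I_{a_M}, I_{b_M}) → 0` whenever `a_M/b_M → ρ ∉ ℕ` (PIVOT-LAW §15.13 (iii) in full; RH-FREE)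

`IntegerScrewFarCovariance.tendsto_farCov_half` proved the third leg of the order-`1/M` covariance trichotomy
(PIVOT-LAW §15.13) at the half-integer ratios along special sequences.  Here the general statement: if
`a_M/M → α`, `b_M/M → β` with `0 < β < α` and `α/β` is NOT a natural number, then
`M·[Ψ(log(a/(b−1))) + Ψ(log((a−1)/b)) − Ψ(log(a/b)) − Ψ(log((a−1)/(b−1)))] → 0` (`a = a_M`, `b = b_M`).
Mechanism: the four lags tend to `ℓ = log(α/β)`, which lies strictly inside a gap `(log N, log(N+1))` of the
prime sum `φ`; there `φ` is affine, so its mixed second difference vanishes identically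
(`IntegerScrewHingeCarrier.zetaScrewPrimeSum_eq_of_mem_Icc`), and the wall part `Ψ_wall` is `C¹`, so its mixed
difference over a cell of sides `log(b/(b−1)) ≍ 1/(βM)` and `log(a/(a−1))` is `o(1/M)`
(`IntegerScrewHingeCovariance.wallPsi_mixed_le`).  So at order `1/M` an increment correlates ONLY with its
neighbours (ratio `1`: `c_k/2`, `IntegerScrewIncrementCovLag`) and with the hinge carriers (integer ratios:
`−Λ(n)/√n`, `IntegerScrewHingeBrackets`):

* `fourLag_identity` — `P₁ + P₂ = P₃ + P₄` for the four lags;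
* `primeSum_fourPoint_eq_zero_of_gap` — `φ(P₁) + φ(P₂) − φ(P₃) − φ(P₄) = 0` when all four lie in one gap;
* **`tendsto_mul_farBracket_zero`** — the decorrelation theorem above.

Elementary real analysis on the explicit `Ψ`; nothing here bears on the truth of RH. [Suzuki2023, (1.1)]
-/

noncomputable section

-- D-0017: `Summit.<S>.<S>.…` is the designed namespace of a single-problem summit.
set_option linter.dupNamespace false

namespace Summit.RiemannHypothesis.RiemannHypothesis.Theorems.IntegerScrew

open Literature.NumberTheory.LFunctions Literature.NumberTheory.LFunctions.Suzuki2023Thm41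
open Filter Set Finset
open scoped Topology

/-- On one gap `[log N, log(N+1)]` (`N ≥ 1`) the prime sum is affine, so its four-point mixed difference
vanishes whenever `P₁ + P₂ = P₃ + P₄`. [folklore] -/
theorem primeSum_fourPoint_eq_zero_of_gap {N : ℕ} (hN : 1 ≤ N) {P₁ P₂ P₃ P₄ : ℝ}
    (h₁ : P₁ ∈ Icc (Real.log N) (Real.log (N + 1))) (h₂ : P₂ ∈ Icc (Real.log N) (Real.log (N + 1)))
    (h₃ : P₃ ∈ Icc (Real.log N) (Real.log (N + 1))) (h₄ : P₄ ∈ Icc (Real.log N) (Real.log (N + 1)))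
    (hsum : P₁ + P₂ = P₃ + P₄) :
    zetaScrewPrimeSum P₁ + zetaScrewPrimeSum P₂ - zetaScrewPrimeSum P₃ - zetaScrewPrimeSum P₄ = 0 := by
  rw [zetaScrewPrimeSum_eq_of_mem_Icc hN h₁.1 h₁.2, zetaScrewPrimeSum_eq_of_mem_Icc hN h₂.1 h₂.2,
    zetaScrewPrimeSum_eq_of_mem_Icc hN h₃.1 h₃.2, zetaScrewPrimeSum_eq_of_mem_Icc hN h₄.1 h₄.2,
    ← Finset.sum_add_distrib, ← Finset.sum_sub_distrib, ← Finset.sum_sub_distrib]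
  refine Finset.sum_eq_zero fun n _ => ?_
  have : P₁ - Real.log n + (P₂ - Real.log n) - (P₃ - Real.log n) - (P₄ - Real.log n) = 0 := by linarith
  calc ArithmeticFunction.vonMangoldt n / Real.sqrt n * (P₁ - Real.log n)
        + ArithmeticFunction.vonMangoldt n / Real.sqrt n * (P₂ - Real.log n)
        - ArithmeticFunction.vonMangoldt n / Real.sqrt n * (P₃ - Real.log n)
        - ArithmeticFunction.vonMangoldt n / Real.sqrt n * (P₄ - Real.log n)
      = ArithmeticFunction.vonMangoldt n / Real.sqrt n
          * (P₁ - Real.log n + (P₂ - Real.log n) - (P₃ - Real.log n) - (P₄ - Real.log n)) := by ring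
    _ = 0 := by rw [this, mul_zero]

/-- Eventually (in `M : ℕ`) the real cast exceeds any given real. [folklore] -/
private theorem eventually_natCast_gt₄ (c : ℝ) : ∀ᶠ M : ℕ in atTop, c < (M : ℝ) :=
  tendsto_natCast_atTop_atTop.eventually (eventually_gt_atTop c)

/-- **FAR DECORRELATION AT NON-INTEGER RATIOS.**  Let `a, b : ℕ → ℕ` with `a_M/M → α`, `b_M/M → β`,
`0 < β < α`, and `α/β ≠ n` for every `n : ℕ`.  Then
`M·[Ψ(log(a/(b−1))) + Ψ(log((a−1)/b)) − Ψ(log(a/b)) − Ψ(log((a−1)/(b−1)))] → 0` (`a = a_M`, `b = b_M`), i.e.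
`M·Cov(I_{a_M}, I_{b_M}) → 0`: two increments of the screw line at a fixed non-integer ratio are uncorrelated
at order `1/M`. [folklore] -/
theorem tendsto_mul_farBracket_zero (a b : ℕ → ℕ) {α β : ℝ} (hβ : 0 < β) (hαβ : β < α)
    (hnat : ∀ n : ℕ, α / β ≠ n)
    (ha : Tendsto (fun M : ℕ => (a M : ℝ) / M) atTop (𝓝 α))
    (hb : Tendsto (fun M : ℕ => (b M : ℝ) / M) atTop (𝓝 β)) :
    Tendsto (fun M : ℕ => (M : ℝ) * (zetaScrew (Real.log ((a M : ℝ) / ((b M : ℝ) - 1)))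
        + zetaScrew (Real.log (((a M : ℝ) - 1) / (b M : ℝ)))
        - zetaScrew (Real.log ((a M : ℝ) / (b M : ℝ)))
        - zetaScrew (Real.log (((a M : ℝ) - 1) / ((b M : ℝ) - 1))))) atTop (𝓝 0) := by
  have hα : 0 < α := hβ.trans hαβ
  have hρ1 : 1 < α / β := by rw [lt_div_iff₀ hβ, one_mul]; exact hαβ
  set ℓ : ℝ := Real.log (α / β) with hℓ
  have hℓ0 : 0 < ℓ := Real.log_pos hρ1
  -- the gap (log N, log(N+1)) containing ℓ strictly
  set N : ℕ := ⌊α / β⌋₊ with hNdef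
  have hN1 : 1 ≤ N := Nat.le_floor (by exact_mod_cast hρ1.le)
  have hNlt : (N : ℝ) < α / β := lt_of_le_of_ne (Nat.floor_le (by positivity)) (fun h => hnat N h.symm)
  have hltN : α / β < (N : ℝ) + 1 := Nat.lt_floor_add_one _
  have hN0 : (0 : ℝ) < N := by exact_mod_cast hN1
  have hlogN : Real.log N < ℓ := Real.log_lt_log hN0 hNlt
  have hlogN1 : ℓ < Real.log ((N : ℝ) + 1) := Real.log_lt_log (by positivity) hltN
  have hgap : Ioo (Real.log N) (Real.log ((N : ℝ) + 1)) ∈ 𝓝 ℓ := Ioo_mem_nhds hlogN hlogN1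
  -- asymptotics of a, b (as in `IntegerScrewFarBrackets`)
  have hinv : Tendsto (fun M : ℕ => (1 : ℝ) / M) atTop (𝓝 0) :=
    tendsto_const_nhds.div_atTop tendsto_natCast_atTop_atTop
  have ha' : Tendsto (fun M : ℕ => ((a M : ℝ) - 1) / M) atTop (𝓝 α) := by
    have := ha.sub hinv
    rw [sub_zero] at this
    exact this.congr fun M => by ring
  have hb' : Tendsto (fun M : ℕ => ((b M : ℝ) - 1) / M) atTop (𝓝 β) := by
    have := hb.sub hinv
    rw [sub_zero] at this
    exact this.congr fun M => by ring
  have haT : Tendsto (fun M : ℕ => (a M : ℝ)) atTop atTop := by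
    refine (ha.pos_mul_atTop hα tendsto_natCast_atTop_atTop).congr' ?_
    filter_upwards [eventually_natCast_gt₄ 0] with M hM
    field_simp
  have hbT : Tendsto (fun M : ℕ => (b M : ℝ)) atTop atTop := by
    refine (hb.pos_mul_atTop hβ tendsto_natCast_atTop_atTop).congr' ?_
    filter_upwards [eventually_natCast_gt₄ 0] with M hM
    field_simp
  have ha2 : ∀ᶠ M : ℕ in atTop, (2 : ℝ) ≤ a M := haT.eventually (eventually_ge_atTop 2)
  have hb2 : ∀ᶠ M : ℕ in atTop, (2 : ℝ) ≤ b M := hbT.eventually (eventually_ge_atTop 2)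
  have hb0 : ∀ᶠ M : ℕ in atTop, (0 : ℝ) < b M := by filter_upwards [hb2] with M hM; linarith
  have hb10 : ∀ᶠ M : ℕ in atTop, (0 : ℝ) < (b M : ℝ) - 1 := by filter_upwards [hb2] with M hM; linarith
  have hlag : ∀ (u v : ℕ → ℝ), Tendsto (fun M : ℕ => u M / M) atTop (𝓝 α) →
      Tendsto (fun M : ℕ => v M / M) atTop (𝓝 β) → (∀ᶠ M : ℕ in atTop, 0 < v M) →
      Tendsto (fun M : ℕ => Real.log (u M / v M)) atTop (𝓝 ℓ) := by
    intro u v hu hv hv0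
    have hq : Tendsto (fun M : ℕ => (u M / M) / (v M / M)) atTop (𝓝 (α / β)) := hu.div hv hβ.ne'
    have hq' : Tendsto (fun M : ℕ => u M / v M) atTop (𝓝 (α / β)) := by
      refine hq.congr' ?_
      filter_upwards [eventually_natCast_gt₄ 0, hv0] with M hM hvM
      field_simp
    exact (Real.continuousAt_log (by positivity : α / β ≠ 0)).tendsto.comp hq'
  -- the lags P₃ = log(a/b) → ℓ, and the cell sides h_a = log(a/(a−1)) → 0, h_b = log(b/(b−1)) → 0
  have hP3 := hlag (fun M => (a M : ℝ)) (fun M => (b M : ℝ)) ha hb hb0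
  have hP1 := hlag (fun M => (a M : ℝ)) (fun M => (b M : ℝ) - 1) ha hb' hb10
  have hP2 := hlag (fun M => (a M : ℝ) - 1) (fun M => (b M : ℝ)) ha' hb hb0
  have hP4 := hlag (fun M => (a M : ℝ) - 1) (fun M => (b M : ℝ) - 1) ha' hb' hb10
  have hside : ∀ (u : ℕ → ℝ), Tendsto u atTop atTop →
      Tendsto (fun M : ℕ => Real.log (u M / (u M - 1))) atTop (𝓝 0) := by
    intro u hu
    have h1 : Tendsto (fun M => u M / (u M - 1)) atTop (𝓝 1) := by
      have hi : Tendsto (fun M => (u M)⁻¹) atTop (𝓝 0) := hu.inv_tendsto_atTop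
      have h2 : Tendsto (fun M => (1 : ℝ) / (1 - (u M)⁻¹)) atTop (𝓝 (1 / (1 - 0))) :=
        tendsto_const_nhds.div (tendsto_const_nhds.sub hi) (by norm_num)
      rw [sub_zero, div_one] at h2
      refine h2.congr' ?_
      filter_upwards [hu.eventually (eventually_gt_atTop 1)] with M hM
      have : u M ≠ 0 := by linarith
      field_simp
    have := (Real.continuousAt_log one_ne_zero).tendsto.comp h1
    simpa only [Function.comp_def, Real.log_one] using this
  have hha := hside (fun M => (a M : ℝ)) haT
  have hhb := hside (fun M => (b M : ℝ)) hbT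
  -- M·h_b is eventually ≤ 2/β
  have hMb : Tendsto (fun M : ℕ => (M : ℝ) / ((b M : ℝ) - 1)) atTop (𝓝 (1 / β)) := by
    have h := hb'.inv₀ hβ.ne'
    refine (h.congr' ?_).trans (by rw [one_div])
    filter_upwards [eventually_natCast_gt₄ 0] with M hM
    rw [inv_div]
  have hMb2 : ∀ᶠ M : ℕ in atTop, (M : ℝ) / ((b M : ℝ) - 1) ≤ 2 / β :=
    hMb.eventually (Iic_mem_nhds (by rw [one_div, lt_div_iff₀ hβ, inv_mul_cancel₀ hβ.ne']; norm_num))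
  -- ε–argument
  rw [Metric.tendsto_atTop]
  intro η hη
  obtain ⟨δ, hδ0, hδ⟩ := wallPsi_mixed_le hℓ0 (show 0 < η * β / 4 by positivity)
  have hsmall : Icc (ℓ - δ) (ℓ + δ) ∈ 𝓝 ℓ := Icc_mem_nhds (by linarith) (by linarith)
  have hsmall0 : Icc (-δ) δ ∈ 𝓝 (0 : ℝ) := Icc_mem_nhds (by linarith) (by linarith)
  have hev : ∀ᶠ M : ℕ in atTop,
      Real.log ((a M : ℝ) / (b M : ℝ)) ∈ Icc (ℓ - δ) (ℓ + δ)
      ∧ Real.log ((a M : ℝ) / ((a M : ℝ) - 1)) ∈ Icc (-δ) δ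
      ∧ Real.log ((b M : ℝ) / ((b M : ℝ) - 1)) ∈ Icc (-δ) δ
      ∧ Real.log ((a M : ℝ) / ((b M : ℝ) - 1)) ∈ Ioo (Real.log N) (Real.log ((N : ℝ) + 1))
      ∧ Real.log (((a M : ℝ) - 1) / (b M : ℝ)) ∈ Ioo (Real.log N) (Real.log ((N : ℝ) + 1))
      ∧ Real.log ((a M : ℝ) / (b M : ℝ)) ∈ Ioo (Real.log N) (Real.log ((N : ℝ) + 1))
      ∧ Real.log (((a M : ℝ) - 1) / ((b M : ℝ) - 1)) ∈ Ioo (Real.log N) (Real.log ((N : ℝ) + 1))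
      ∧ (2 : ℝ) ≤ a M ∧ (2 : ℝ) ≤ b M ∧ (M : ℝ) / ((b M : ℝ) - 1) ≤ 2 / β ∧ (0 : ℝ) < M := by
    filter_upwards [hP3.eventually hsmall, hha.eventually hsmall0, hhb.eventually hsmall0,
      hP1.eventually hgap, hP2.eventually hgap, hP3.eventually hgap, hP4.eventually hgap, ha2, hb2, hMb2,
      eventually_natCast_gt₄ 0] with M h1 h2 h3 h4 h5 h6 h7 h8 h9 h10 h11
    exact ⟨h1, h2, h3, h4, h5, h6, h7, h8, h9, h10, h11⟩
  obtain ⟨M₀, hM₀⟩ := eventually_atTop.1 hev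
  refine ⟨M₀, fun M hM => ?_⟩
  obtain ⟨h3, hha', hhb', g1, g2, g3, g4, haM, hbM, hMbM, hM0⟩ := hM₀ M hM
  have ha0 : (0 : ℝ) < a M := by linarith
  have ha1 : (0 : ℝ) < (a M : ℝ) - 1 := by linarith
  have hb0' : (0 : ℝ) < b M := by linarith
  have hb1 : (0 : ℝ) < (b M : ℝ) - 1 := by linarith
  -- names for the lags and the sides
  set x : ℝ := Real.log ((a M : ℝ) / (b M : ℝ)) with hx
  set sa : ℝ := Real.log ((a M : ℝ) / ((a M : ℝ) - 1)) with hsa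
  set sb : ℝ := Real.log ((b M : ℝ) / ((b M : ℝ) - 1)) with hsb
  have e1 : Real.log ((a M : ℝ) / ((b M : ℝ) - 1)) = x + sb := by
    simp only [hx, hsb]
    rw [Real.log_div ha0.ne' hb1.ne', Real.log_div ha0.ne' hb0'.ne', Real.log_div hb0'.ne' hb1.ne']; ring
  have e2 : Real.log (((a M : ℝ) - 1) / (b M : ℝ)) = x - sa := by
    simp only [hx, hsa]
    rw [Real.log_div ha1.ne' hb0'.ne', Real.log_div ha0.ne' hb0'.ne', Real.log_div ha0.ne' ha1.ne']; ring
  have e4 : Real.log (((a M : ℝ) - 1) / ((b M : ℝ) - 1)) = x + sb - sa := by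
    simp only [hx, hsa, hsb]
    rw [Real.log_div ha1.ne' hb1.ne', Real.log_div ha0.ne' hb0'.ne', Real.log_div ha0.ne' ha1.ne',
      Real.log_div hb0'.ne' hb1.ne']; ring
  have hsa0 : 0 ≤ sa := Real.log_nonneg (by rw [le_div_iff₀ ha1]; linarith)
  have hsb0 : 0 ≤ sb := Real.log_nonneg (by rw [le_div_iff₀ hb1]; linarith)
  -- all four lags are ≥ 0 (they exceed log N ≥ 0)
  have hlogN0 : 0 ≤ Real.log (N : ℝ) := Real.log_nonneg (by exact_mod_cast hN1)
  have hpos : ∀ {P : ℝ}, P ∈ Ioo (Real.log N) (Real.log ((N : ℝ) + 1)) → 0 ≤ P :=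
    fun hP => hlogN0.trans hP.1.le
  -- Ψ = Ψ_wall − φ at the four lags; the φ part vanishes
  have hφ : zetaScrewPrimeSum (x + sb) + zetaScrewPrimeSum (x - sa) - zetaScrewPrimeSum x
      - zetaScrewPrimeSum (x + sb - sa) = 0 := by
    rw [← e4, ← e1, ← e2]
    exact primeSum_fourPoint_eq_zero_of_gap hN1 (Ioo_subset_Icc_self g1) (Ioo_subset_Icc_self g2)
      (Ioo_subset_Icc_self g3) (Ioo_subset_Icc_self g4) (by rw [e1, e2, e4]; ring)
  have hwall : |wallPsi (x + sb) + wallPsi (x - sa) - wallPsi x - wallPsi (x + sb - sa)| ≤ η * β / 4 * sb := by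
    refine hδ x sb sa ?_ hsb0 ?_ hsa0 ?_
    · have := h3; rw [Set.mem_Icc] at this; rw [abs_le]; constructor <;> linarith
    · exact (Set.mem_Icc.1 hhb').2
    · exact (Set.mem_Icc.1 hha').2
  have hB : zetaScrew (Real.log ((a M : ℝ) / ((b M : ℝ) - 1)))
        + zetaScrew (Real.log (((a M : ℝ) - 1) / (b M : ℝ)))
        - zetaScrew (Real.log ((a M : ℝ) / (b M : ℝ)))
        - zetaScrew (Real.log (((a M : ℝ) - 1) / ((b M : ℝ) - 1)))
      = wallPsi (x + sb) + wallPsi (x - sa) - wallPsi x - wallPsi (x + sb - sa) := by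
    rw [e1, e2, e4, ← hx, zetaScrew_eq_wallPsi_sub_primeSum (by rw [← e1]; exact hpos g1),
      zetaScrew_eq_wallPsi_sub_primeSum (by rw [← e2]; exact hpos g2),
      zetaScrew_eq_wallPsi_sub_primeSum (hpos g3),
      zetaScrew_eq_wallPsi_sub_primeSum (by rw [← e4]; exact hpos g4)]
    linarith [hφ]
  rw [Real.dist_eq, sub_zero, hB, abs_mul, abs_of_pos hM0]
  -- M·(ηβ/4)·sb ≤ (ηβ/4)·(M/(b−1)) ≤ (ηβ/4)(2/β) = η/2 < η
  have hsb1 : sb ≤ 1 / ((b M : ℝ) - 1) := by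
    have := Real.log_le_sub_one_of_pos (show 0 < (b M : ℝ) / ((b M : ℝ) - 1) by positivity)
    have e : (b M : ℝ) / ((b M : ℝ) - 1) - 1 = 1 / ((b M : ℝ) - 1) := by field_simp; ring
    simp only [hsb]; linarith [e]
  calc (M : ℝ) * |wallPsi (x + sb) + wallPsi (x - sa) - wallPsi x - wallPsi (x + sb - sa)|
      ≤ (M : ℝ) * (η * β / 4 * sb) := mul_le_mul_of_nonneg_left hwall hM0.le
    _ ≤ (M : ℝ) * (η * β / 4 * (1 / ((b M : ℝ) - 1))) := by gcongr
    _ = η * β / 4 * ((M : ℝ) / ((b M : ℝ) - 1)) := by ring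
    _ ≤ η * β / 4 * (2 / β) := by gcongr
    _ = η / 2 := by field_simp; ring
    _ < η := by linarith

end Summit.RiemannHypothesis.RiemannHypothesis.Theorems.IntegerScrew

end
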